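/-
Copyright (c) 2026 the pub-hodgecm-mathlib formalisation cell (harness21).  Prover seat hodgecm-mathlib-K2E4-p14 (g13), R90-TF SLAB section S4
«Ch13.1–2» (base R90-C131, across-lines valve hand), h413 = `stmt-HodgeConjecture-24833`; brick (DICT)(2) FILE 0, the (β ⇒ α) bridge
(S4 dealer K2E2-plan (g8), R90 bus 2026-09-05T02:16:11Z).
-/
import Summits.HodgeConjecture.HodgeConjecture.Theorems.R90S4TypeTwoStableClassSplit    -- ★ p864495 F1″ (R90-C131-p05): `exists_isStablyConjGAt_iff_isConj_or_gqs` (the block-frame letter (α) consumer)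
import Literature.LinearAlgebra.Matrix.CyclicVectorCompanionMatrix                      -- ★ `companion`, `charpoly_companion`, `exists_conj_eq_of_minpoly_eq_charpoly` (Horn–Johnson 3.3.14, 3.3.P12)
import Literature.LinearAlgebra.DiagonalizableEigenspaces                                -- ★ `minpoly_eq_charpoly_of_squarefree_charpoly` (Adkins–Weintraub (4.32))
import HarnessLib

/-!
# R90-TF · S4 — (DICT)(2) FILE 0 `R90S4TypeTwoBlockFrameOfCharpoly`: the (β ⇒ α) bridge — a `3 × 3` matrix over a field whose characteristic polynomial is
# `q · (X − u)` with `q` an irreducible quadratic admits a block frame `γ · P = P · [A 0; 0 u]` with `χ_A = q` (Rogawski 1990, §3.6 type (2): `T ≅ T_K × E¹`)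

Cell `hodgecm-mathlib`, crux H413 = `stmt-HodgeConjecture-24833`, route of record `HCCMUnconditional`; R90-TF section S4 (Rogawski Ch. 13.1–2, base `R90-C131`),
S4 dealer K2E2-plan (g8), hand K2E4-p14 (g13) (across-lines valve).  FILE 0 of the brick (DICT)(2): the members of the Cartan cover arrive through the
FACTORISATION OF THE CHARACTERISTIC POLYNOMIAL (letter (β): «`χ_γ = q · (X − u)`, `q` irreducible quadratic»), while ★ F1″ `R90S4TypeTwoStableClassSplit`
(p864495) consumes the BLOCK-FRAME letter (α) («`γ · P = P · [A 0; 0 u]`, `χ_A` irreducible»).  This file is the bridge (β) ⇒ (α).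
THEOREMS ONLY (no `def`, no `instance`, no notation, no named-fact hypothesis, no `sorry`; default heartbeats); ★-only imports; lane
`--supports stmt-HodgeConjecture-24833 --as helper`.

THE MATHEMATICS.  Over a field `K`, let `γ ∈ M₃(K)` have `χ_γ = q · (X − u)` with `q ∈ K[X]` irreducible of degree `2` (so `q` is monic, being a monic-complemented
factor of the monic `χ_γ`, and `q(u) ≠ 0`, an irreducible quadratic having no root).  Then `χ_γ` is SQUAREFREE (`q` and `X − u` are non-associated irreducibles),
hence the minimal polynomial of `γ` is `χ_γ` (Adkins–Weintraub (4.32): every irreducible factor of `χ` divides `μ`).  The block matrix `B = [C_q 0; 0 u]`, `C_q` the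
companion matrix of `q` (Horn–Johnson Thm 3.3.14: `χ_{C_q} = q`), has the same characteristic polynomial `q · (X − u)` (block-triangular determinant), so the
same minimal polynomial; two non-derogatory matrices with the same characteristic polynomial are similar (Horn–Johnson Thm 3.3.15, 3.3.P12): `B = S⁻¹ γ S`,
i.e. `γ · S = S · B`.  This is print's decomposition `K³ = ker q(γ) ⊕ ker (γ − u)` of [§3.6 type (2)] (`Z(γ) ≅ L₄ × L_w` there), read through the tree's
companion-matrix calculus instead of an adapted basis.
* `exists_blockFrame_of_charpoly_eq_mul` — the bridge over any field `K` (with `χ_A = q`);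
* `exists_blockFrame_gqs_of_charpoly` — the same on the S4 carrier `Gqs L v = U(Φ₃)(L⁺_v)` at a finite place `v` of `L⁺` NON-SPLIT in `L` (`L ⊗ L⁺_v = L_w` is a
  field, ★ `LocalRing.isField_of_smul_eq`), producing EXACTLY the binders `(P) (e) (A) (u) (hP) (hA)` of ★ `exists_isStablyConjGAt_iff_isConj_or_gqs`;
* `exists_isStablyConjGAt_iff_isConj_or_gqs_of_charpoly` — the composition: F1″'s two-classes statement from the letter (β).

HONEST LABEL: HC_CM is proved only modulo the 7 printed citations (2 remaining named inputs: hLiu418 = `stmt-HodgeConjecture-24832`, h413 = `stmt-HodgeConjecture-24833`) until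
rung 0 closes; a bridge lemma behind (DICT)(2) behind the OPEN (W-NP) socket — a ★ helper closes no socket; REL ≠ ★ ≠ BUILT; count-neutral.

## References
* [Rogawski1990] J. D. Rogawski, *Automorphic Representations of Unitary Groups in Three Variables*, Ann. of Math. Stud. 123 (1990), §3.6 pp. 28–29 (the Cartan
  subgroups of `U(3)`, type (2): `T = T_K × E¹`, `γ` with an irreducible quadratic factor of `χ_γ`), §3.5 Prop. 3.5.2 (c) p. 26.
* [HornJohnson2013] R. A. Horn, C. R. Johnson, *Matrix Analysis*, 2nd ed. (CUP 2013), (3.3.12)–Thm 3.3.14 p. 256, Thm 3.3.15 p. 257, 3.3.P12 p. 258.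
* [AdkinsWeintraub1992] W. A. Adkins, S. H. Weintraub, *Algebra. An Approach via Module Theory*, GTM 136 (1992), Ch. 4 (4.32) Corollary.
-/

set_option autoImplicit false
-- the mandated namespace repeats the single-problem summit's segment (`HodgeConjecture.HodgeConjecture`)
set_option linter.dupNamespace false

open Matrix Polynomial
open NumberField IsDedekindDomain
open Literature.NumberTheory.Automorphic Literature.NumberTheory.Automorphic.UnitaryGroup Literature.NumberTheory.Rogawski1990
open scoped MatrixGroups

namespace Summit.HodgeConjecture.HodgeConjecture.R90.S4

/-! ## §1 The bridge over a field -/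

section Field

variable {K : Type*} [Field K]

/-- The `1 × 1` matrix `!![u]` has characteristic polynomial `X − u`. [folklore] -/
theorem charpoly_fin_one_of (u : K) : (!![u] : Matrix (Fin 1) (Fin 1) K).charpoly = X - C u := by
  have h : (!![u] : Matrix (Fin 1) (Fin 1) K) = diagonal fun _ => u := by
    ext i j
    fin_cases i; fin_cases j
    rfl
  rw [h, charpoly_diagonal, Fin.prod_univ_one]

/-- A monic-complemented factor of a characteristic polynomial: if `χ_γ = q · (X − u)` then `q` is monic. [folklore] -/
theorem monic_of_charpoly_eq_mul {m : ℕ} (γ : Matrix (Fin m) (Fin m) K) {q : K[X]} {u : K} (hchar : γ.charpoly = q * (X - C u)) :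
    q.Monic :=
  (monic_X_sub_C u).of_mul_monic_right (hchar ▸ charpoly_monic γ)

/-- An irreducible polynomial of degree `2` and a linear polynomial `X − u` give a SQUAREFREE product `q · (X − u)` (`q` has no root, so `X − u ∤ q`; both factors
are irreducible). [folklore] -/
theorem squarefree_mul_X_sub_C_of_irreducible {q : K[X]} (hq : Irreducible q) (hq2 : q.natDegree = 2) (u : K) : Squarefree (q * (X - C u)) := by
  have hXu : Irreducible (X - C u) := irreducible_X_sub_C u
  have hndvd : ¬ (X - C u) ∣ q := by
    intro h
    have h1 := degree_eq_one_of_irreducible_of_root hq (dvd_iff_isRoot.mp h)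
    rw [degree_eq_natDegree hq.ne_zero, hq2] at h1
    exact absurd h1 (by decide)
  exact squarefree_mul_iff.2 ⟨(hXu.isRelPrime_iff_not_dvd.2 hndvd).symm, hq.squarefree, hXu.squarefree⟩

/-- A square matrix over a field with SQUAREFREE characteristic polynomial is non-derogatory: `μ_γ = χ_γ` (Adkins–Weintraub (4.32), matrix form via `toLin'`).
[cite: AdkinsWeintraub1992, Ch. 4 (4.32) Corollary] [cite: HornJohnson2013, Thm 3.3.15 p. 257] -/
theorem minpoly_eq_charpoly_of_squarefree {m : ℕ} (γ : Matrix (Fin m) (Fin m) K) (h : Squarefree γ.charpoly) : minpoly K γ = γ.charpoly := by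
  rw [← Matrix.minpoly_toLin', ← Matrix.charpoly_toLin']
  exact Literature.LinearAlgebra.minpoly_eq_charpoly_of_squarefree_charpoly _ (by rwa [Matrix.charpoly_toLin'])

/-- The companion matrix of a monic quadratic `q` has characteristic polynomial `q` (Horn–Johnson Thm 3.3.14 at `n = 2`). [cite: HornJohnson2013, Thm 3.3.14 p. 256] -/
theorem charpoly_companion_of_monic_two {q : K[X]} (hqm : q.Monic) (hq2 : q.natDegree = 2) :
    (Literature.LinearAlgebra.Matrix.companion fun i : Fin 2 => q.coeff i).charpoly = q := by
  rw [Literature.LinearAlgebra.Matrix.charpoly_companion, Fin.sum_univ_eq_sum_range (fun i => C (q.coeff i) * X ^ i) 2]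
  conv_rhs => rw [hqm.as_sum, hq2]

/-- **THE (β ⇒ α) BRIDGE OVER A FIELD.**  If `γ ∈ M₃(K)` has characteristic polynomial `q · (X − u)` with `q` IRREDUCIBLE of degree `2`, then there are an invertible
`P`, a block pattern `e : Fin 2 ⊕ Fin 1 ≃ Fin 3` and `A ∈ M₂(K)` with `γ · P = P · [A 0; 0 u]` and `χ_A = q` (so `χ_A` is irreducible) — print's decomposition
`K³ = ker q(γ) ⊕ ker (γ − u)` of a type-(2) element, obtained here by similarity of the two non-derogatory matrices `γ` and `[C_q 0; 0 u]` with the common squarefree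
characteristic polynomial `q · (X − u)`. [cite: Rogawski1990, §3.6 p. 28] [cite: HornJohnson2013, Thm 3.3.15 p. 257, 3.3.P12 p. 258] -/
theorem exists_blockFrame_of_charpoly_eq_mul (γ : Matrix (Fin 3) (Fin 3) K) (q : K[X]) (u : K) (hq : Irreducible q) (hq2 : q.natDegree = 2)
    (hchar : γ.charpoly = q * (X - C u)) :
    ∃ (P : GL (Fin 3) K) (e : Fin 2 ⊕ Fin 1 ≃ Fin 3) (A : Matrix (Fin 2) (Fin 2) K),
      γ * P.val = P.val * reindex e e (fromBlocks A 0 0 !![u]) ∧ A.charpoly = q := by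
  -- the companion block and the block pattern
  set A : Matrix (Fin 2) (Fin 2) K := Literature.LinearAlgebra.Matrix.companion fun i : Fin 2 => q.coeff i with hAdef
  have hA : A.charpoly = q := charpoly_companion_of_monic_two (monic_of_charpoly_eq_mul γ hchar) hq2
  set e : Fin 2 ⊕ Fin 1 ≃ Fin 3 := finSumFinEquiv with hedef
  set B : Matrix (Fin 3) (Fin 3) K := reindex e e (fromBlocks A 0 0 !![u]) with hBdef
  -- the two characteristic polynomials agree and are squarefree
  have hB : B.charpoly = γ.charpoly := by
    rw [hBdef, charpoly_reindex, charpoly_fromBlocks_zero₁₂, hA, charpoly_fin_one_of, hchar]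
  have hsq : Squarefree γ.charpoly := hchar ▸ squarefree_mul_X_sub_C_of_irreducible hq hq2 u
  -- two non-derogatory matrices with the same characteristic polynomial are similar
  obtain ⟨S, hS, hSe⟩ := Literature.LinearAlgebra.Matrix.exists_conj_eq_of_minpoly_eq_charpoly γ B
    (minpoly_eq_charpoly_of_squarefree γ hsq) (minpoly_eq_charpoly_of_squarefree B (hB.symm ▸ hsq)) hB.symm
  refine ⟨Matrix.GeneralLinearGroup.mkOfDetNeZero S hS.ne_zero, e, A, ?_, hA⟩
  show γ * S = S * B
  rw [hSe, ← Matrix.mul_assoc, ← Matrix.mul_assoc, Matrix.mul_nonsing_inv S hS, Matrix.one_mul]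

end Field

/-! ## §2 On the S4 carrier `Gqs L v = U(Φ₃)(L⁺_v)` at a non-split place -/

section Gqs

variable (L : Type) [Field L] [NumberField L] [IsCMField L] (v : HeightOneSpectrum (𝓞 ↥(maximalRealSubfield L)))

/-- **THE (β ⇒ α) BRIDGE ON `Gqs L v`** (`v` non-split, so `L ⊗ L⁺_v = L_w` is a field): a `γ ∈ U(Φ₃)(L⁺_v)` whose characteristic polynomial is `q · (X − u)` with `q`
irreducible quadratic over `L_w` has a block frame `γ · P = P · [A 0; 0 u]` with `χ_A = q` irreducible — EXACTLY the binders `(P) (e) (A) (u) (hP) (hA)` of ★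
`exists_isStablyConjGAt_iff_isConj_or_gqs` (type (2) of [§3.6]: `Z(γ) ≅ L₄ × L_w`, `T ≅ T_K × E¹`). [cite: Rogawski1990, §3.6 p. 28; §12.5 p. 182]
[cite: HornJohnson2013, Thm 3.3.15 p. 257, 3.3.P12 p. 258] -/
theorem exists_blockFrame_gqs_of_charpoly (hns : ∀ w : PlacesOver L v, IsCMField.complexConj L • w.1 = w.1) (γ : Gqs L v)
    (q : (LocalRing L v)[X]) (u : LocalRing L v) (hq : Irreducible q) (hq2 : q.natDegree = 2)
    (hchar : (γ.val : GL (Fin 3) (LocalRing L v)).val.charpoly = q * (X - C u)) :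
    ∃ (P : GL (Fin 3) (LocalRing L v)) (e : Fin 2 ⊕ Fin 1 ≃ Fin 3) (A : Matrix (Fin 2) (Fin 2) (LocalRing L v)),
      (γ.val : GL (Fin 3) (LocalRing L v)).val * P.val = P.val * reindex e e (fromBlocks A 0 0 !![u]) ∧ A.charpoly = q ∧ Irreducible A.charpoly := by
  haveI : Algebra.IsQuadraticExtension ↥(maximalRealSubfield L) L := IsCMField.isQuadraticExtension L
  obtain ⟨w⟩ := (inferInstance : Nonempty (PlacesOver L v))
  letI : Field (LocalRing L v) := (LocalRing.isField_of_smul_eq (IsCMField.complexConj L) (IsCMField.complexConj_ne_one L) w (hns w)).toField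
  obtain ⟨P, e, A, hP, hA⟩ := exists_blockFrame_of_charpoly_eq_mul (γ.val : GL (Fin 3) (LocalRing L v)).val q u hq hq2 hchar
  exact ⟨P, e, A, hP, hA, hA.symm ▸ hq⟩

/-- **TYPE (2) FROM THE CHARACTERISTIC POLYNOMIAL: EXACTLY TWO CLASSES IN THE STABLE CLASS** (`v` non-split): for `γ ∈ U(Φ₃)(L⁺_v)` with `χ_γ = q · (X − u)`, `q`
irreducible quadratic, there is `γ₂` stably conjugate and not conjugate to `γ`, and `γ′ ∼_{st} γ ⟺ γ′ ∼ γ ∨ γ′ ∼ γ₂` — ★ F1″ `exists_isStablyConjGAt_iff_isConj_or_gqs`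
through the bridge. [cite: Rogawski1990, §3.5 Prop. 3.5.2 (c) p. 26; §3.6 p. 28; §12.5 p. 182] -/
theorem exists_isStablyConjGAt_iff_isConj_or_gqs_of_charpoly (hns : ∀ w : PlacesOver L v, IsCMField.complexConj L • w.1 = w.1) (γ : Gqs L v)
    (q : (LocalRing L v)[X]) (u : LocalRing L v) (hq : Irreducible q) (hq2 : q.natDegree = 2)
    (hchar : (γ.val : GL (Fin 3) (LocalRing L v)).val.charpoly = q * (X - C u)) :
    ∃ γ₂ : Gqs L v, IsStablyConjGAt L (splitFormGL L) v γ γ₂ ∧ ¬ IsConj γ γ₂ ∧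
      ∀ γ' : Gqs L v, IsStablyConjGAt L (splitFormGL L) v γ γ' ↔ (IsConj γ γ' ∨ IsConj γ₂ γ') := by
  obtain ⟨P, e, A, hP, -, hA⟩ := exists_blockFrame_gqs_of_charpoly L v hns γ q u hq hq2 hchar
  exact exists_isStablyConjGAt_iff_isConj_or_gqs L v hns γ P e A u hP hA

end Gqs

end Summit.HodgeConjecture.HodgeConjecture.R90.S4
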